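import Literature.Barriers.BirchSwinnertonDyer.RankNotSumOfLocalInvariantsK1LocalOdd
import Mathlib.Data.Fintype.Prod
import HarnessLib

/-!
# `rk E(F₄)` for `E = 480a1` via `ℚ(√-1)`, VI: the local conditions at the ramified prime `1 + i`

The dyadic part of the complete `2`-descents over `K1 = ℚ(√-1)` for the twists
`E^{(d)} : y² = x(x + 2d)(x - 3d)` with `d ≡ 1 (mod 8)` (`d = 1, 41, 73, 2993`): the image of a
`K1`-rational point `(x, y)`, `y ≠ 0`, under `(x, x + 2d)` in
`K_𝔭^×/K_𝔭^{×2} × K_𝔭^×/K_𝔭^{×2}`, `K_𝔭 = ℚ₂(√-1)` (`𝔭 = (1+i)`, `|K_𝔭^×/K_𝔭^{×2}| = 16`),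
satisfies the four linear conditions cutting out the `16`-element image of `E(K_𝔭)/2E(K_𝔭)`
(Silverman AEC X.1, proof of Prop. X.1.4: `#E(K_𝔭)[2] · 4 = 16`); read through the characters
`ord_𝔭`, `re`, `nrm`, `t` of files II–III (`local_dyadic`):

* `ord(b₁) ≡ ord(b₂)`,
* `ord(b₁) + re(b₁) + re(b₂) ≡ 0`, `ord(b₁) + nrm(b₁) + nrm(b₂) ≡ 0` (`re, nrm` read on
  `b₁ b₂ / n²`-free parts, i.e. `re(z) + re(z + 2dn)` etc.),
* `re(b₁) + nrm(b₁) + t(b₁) + t(b₂) ≡ 0`.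

As in file V a point is encoded integrally, `x = z/n`, `y = w/m`,
`w² n³ = m² z (z + 2dn)(z - 3dn)`. The proof is the case analysis on `k = ord_𝔭 z` versus
`a = ord_𝔭 n` (`k < a`; `k = a`; `k = a + 1`; `k = a + 2`; `k ≥ a + 3`, i.e. `ord_𝔭 x < 0`,
`= 0, 1, 2`, `≥ 3`), the parity of `ord_𝔭(y²)` and the unit equation
`W² ν³ = M² · u · U₂ · U₃` between the `𝔭`-unit parts, reduced modulo `8 = 𝔭⁶` (in
`R8 = (ℤ/8)[i]`; squares of units are `≡ ±1, 5+4i, 3+4i (mod 8)`), where each of the thirteen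
residual statements is a finite check over pairs of odd residues (`decide`). Everything is
proved.

## References

* J. H. Silverman, *The Arithmetic of Elliptic Curves*, 2nd ed., GTM 106 (2009), Ch. X §1,
  Prop. X.1.4 (local image at `v ∣ 2`: `#E(K_v)/2E(K_v) = #E(K_v)[2] / |2|_v`).
  [SilvermanAEC2009]
* T. Dokchitser, V. Dokchitser, *A note on the Mordell–Weil rank modulo `n`*, J. Number Theory
  131 (2011) 1833–1839, arXiv:0910.4588, proof of Thm. 2. [DokchitserDokchitser2011RankModN]
-/

namespace Literature.Barriers.BirchSwinnertonDyer.DokchitserDokchitser2011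

open QuadraticAlgebra

/-- Mathlib's Gaussian integers `ℤ√-1` (the notation `ℤ[i]` is local to Mathlib's file). -/
local notation "ℤ[i]" => GaussianInt

/-! ### Finite arithmetic in `R8 = (ℤ/8)[i]` -/

/-- `R8` is finite (`64` elements). [folklore] -/
instance R8.instFintype : Fintype R8 :=
  Fintype.ofEquiv (ZMod 8 × ZMod 8) (QuadraticAlgebra.equivProd (-1) 0).symm

/-- **The square relation**: `P ≡ S · V` for a square `S ∈ {1, -1, 5+4i, 3+4i}` of an odd
residue modulo `8`. [folklore] -/
def R8.SqRel (P V : R8) : Prop :=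
  P = V ∨ P = ⟨7, 0⟩ * V ∨ P = ⟨5, 4⟩ * V ∨ P = ⟨3, 4⟩ * V

/-- `R8.SqRel` is decidable. [folklore] -/
instance (P V : R8) : Decidable (R8.SqRel P V) := by unfold R8.SqRel; infer_instance

/-- Membership in the four squares `{1, -1, 5+4i, 3+4i}` of `R8`. [folklore] -/
def R8.IsSq (S : R8) : Prop := S = 1 ∨ S = ⟨7, 0⟩ ∨ S = ⟨5, 4⟩ ∨ S = ⟨3, 4⟩

/-- `R8.IsSq` is decidable. [folklore] -/
instance (S : R8) : Decidable (R8.IsSq S) := by unfold R8.IsSq; infer_instance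

set_option maxRecDepth 8000 in
/-- The square of an odd residue is one of `1, -1, 5+4i, 3+4i`. [folklore] -/
theorem R8.isSq_mul_self : ∀ X : R8, R8.OddPat X → R8.IsSq (X * X) := by decide

set_option maxRecDepth 8000 in
/-- The four squares are closed under multiplication. [folklore] -/
theorem R8.isSq_mul : ∀ S T : R8, R8.IsSq S → R8.IsSq T → R8.IsSq (S * T) := by decide

/-- The four squares square to `1`. [folklore] -/
theorem R8.isSq_sq_eq_one : ∀ S : R8, R8.IsSq S → S * S = 1 := by decide

/-- `SqRel P V` from `P = S V` with `S` a square. [folklore] -/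
theorem R8.sqRel_of_isSq {S P V : R8} (hS : R8.IsSq S) (h : P = S * V) : R8.SqRel P V := by
  rcases hS with rfl | rfl | rfl | rfl
  · left; rw [h, one_mul]
  · right; left; exact h
  · right; right; left; exact h
  · right; right; right; exact h

/-- **The unit equation modulo `8`**: if `W² V³ = M² P` with `W, M, V` odd residues then
`P ≡ S V` for a square `S`. [folklore] -/
theorem R8.sqRel_of_eq {W M V P : R8} (hW : R8.OddPat W) (hM : R8.OddPat M) (hV : R8.OddPat V)
    (h : W * W * (V * V * V) = M * M * P) : R8.SqRel P V := by
  have hM1 : M * M * (M * M) = 1 := R8.isSq_sq_eq_one _ (R8.isSq_mul_self M hM)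
  refine R8.sqRel_of_isSq (S := M * M * (W * W) * (V * V))
    (R8.isSq_mul _ _ (R8.isSq_mul _ _ (R8.isSq_mul_self M hM) (R8.isSq_mul_self W hW))
      (R8.isSq_mul_self V hV)) ?_
  calc P = M * M * (M * M) * P := by rw [hM1, one_mul]
    _ = M * M * (W * W * (V * V * V)) := by rw [h]; ring
    _ = M * M * (W * W) * (V * V) * V := by ring

set_option maxRecDepth 8000 in
/-- Adding a multiple of `1 + i` preserves oddness. [folklore] -/
theorem R8.oddPat_add_pi_mul : ∀ U X : R8, R8.OddPat U → R8.OddPat (U + ⟨1, 1⟩ * X) := by decide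

set_option maxRecDepth 8000 in
/-- Subtracting a multiple of `1 + i` preserves oddness. [folklore] -/
theorem R8.oddPat_sub_pi_mul : ∀ U X : R8, R8.OddPat U → R8.OddPat (U - ⟨1, 1⟩ * X) := by decide

set_option maxRecDepth 8000 in
/-- `(1+i) X + U` is odd for `U` odd. [folklore] -/
theorem R8.oddPat_pi_mul_add : ∀ U X : R8, R8.OddPat U → R8.OddPat (⟨1, 1⟩ * X + U) := by decide

set_option maxRecDepth 8000 in
/-- `(1+i) X - U` is odd for `U` odd. [folklore] -/
theorem R8.oddPat_pi_mul_sub : ∀ U X : R8, R8.OddPat U → R8.OddPat (⟨1, 1⟩ * X - U) := by decide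

set_option maxRecDepth 8000 in
/-- Products of odd residues are odd. [folklore] -/
theorem R8.oddPat_mul : ∀ U V : R8, R8.OddPat U → R8.OddPat V → R8.OddPat (U * V) := by decide

/-! ### The thirteen finite checks

In each, `U, V` (or `U₃, V`, `U₂, V`) range over odd residues; the hypothesis is the unit
equation `u · U₂ · U₃ ≡ S · ν` modulo `8`, and the conclusion lists
`re(u) + re(U₂)`, `nrm(u) + nrm(U₂)` and `re(u) + re(ν) + nrm(u) + nrm(ν) + t(u) + t(U₂)`. -/

section Finite

set_option maxRecDepth 8000

/-- Case `ord z < ord n`, `ord n - ord z = 2`. [folklore] -/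
theorem R8.fin_N1 : ∀ U V : R8, R8.OddPat U → R8.OddPat V →
    R8.SqRel (U * (U + (⟨1, 1⟩ : R8) ^ (1 + 3) * ⟨0, 7⟩ * V) *
      (U - (⟨1, 1⟩ : R8) ^ (1 + 1) * ⟨3, 0⟩ * V)) V →
    re8 U + re8 (U + (⟨1, 1⟩ : R8) ^ (1 + 3) * ⟨0, 7⟩ * V) = 0 ∧
    nrm8 U + nrm8 (U + (⟨1, 1⟩ : R8) ^ (1 + 3) * ⟨0, 7⟩ * V) = 0 ∧
    re8 U + re8 V + nrm8 U + nrm8 V + t8 U + t8 (U + (⟨1, 1⟩ : R8) ^ (1 + 3) * ⟨0, 7⟩ * V) = 0 := by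
  decide

/-- Case `ord z < ord n`, `ord n - ord z = 4`. [folklore] -/
theorem R8.fin_N3 : ∀ U V : R8, R8.OddPat U → R8.OddPat V →
    R8.SqRel (U * (U + (⟨1, 1⟩ : R8) ^ (3 + 3) * ⟨0, 7⟩ * V) *
      (U - (⟨1, 1⟩ : R8) ^ (3 + 1) * ⟨3, 0⟩ * V)) V →
    re8 U + re8 (U + (⟨1, 1⟩ : R8) ^ (3 + 3) * ⟨0, 7⟩ * V) = 0 ∧
    nrm8 U + nrm8 (U + (⟨1, 1⟩ : R8) ^ (3 + 3) * ⟨0, 7⟩ * V) = 0 ∧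
    re8 U + re8 V + nrm8 U + nrm8 V + t8 U + t8 (U + (⟨1, 1⟩ : R8) ^ (3 + 3) * ⟨0, 7⟩ * V) = 0 := by
  decide

/-- Case `ord z < ord n`, `ord n - ord z ≥ 6`. [folklore] -/
theorem R8.fin_N5 : ∀ U V : R8, R8.OddPat U → R8.OddPat V →
    R8.SqRel (U * (U + 0 * ⟨0, 7⟩ * V) * (U - 0 * ⟨3, 0⟩ * V)) V →
    re8 U + re8 (U + 0 * ⟨0, 7⟩ * V) = 0 ∧ nrm8 U + nrm8 (U + 0 * ⟨0, 7⟩ * V) = 0 ∧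
    re8 U + re8 V + nrm8 U + nrm8 V + t8 U + t8 (U + 0 * ⟨0, 7⟩ * V) = 0 := by
  decide

/-- Case `ord z = ord n`, `ord (u - 3dν) = 2`. [folklore] -/
theorem R8.fin_Z1 : ∀ U V : R8, R8.OddPat U → R8.OddPat V →
    R8.SqRel ((⟨3, 0⟩ * V + (⟨1, 1⟩ : R8) ^ (1 + 1) * U) *
      ((⟨3, 0⟩ + (⟨1, 1⟩ : R8) ^ 2 * ⟨0, 7⟩) * V + (⟨1, 1⟩ : R8) ^ (1 + 1) * U) * U) V →
    re8 (⟨3, 0⟩ * V + (⟨1, 1⟩ : R8) ^ (1 + 1) * U) +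
      re8 ((⟨3, 0⟩ + (⟨1, 1⟩ : R8) ^ 2 * ⟨0, 7⟩) * V + (⟨1, 1⟩ : R8) ^ (1 + 1) * U) = 0 ∧
    nrm8 (⟨3, 0⟩ * V + (⟨1, 1⟩ : R8) ^ (1 + 1) * U) +
      nrm8 ((⟨3, 0⟩ + (⟨1, 1⟩ : R8) ^ 2 * ⟨0, 7⟩) * V + (⟨1, 1⟩ : R8) ^ (1 + 1) * U) = 0 ∧
    re8 (⟨3, 0⟩ * V + (⟨1, 1⟩ : R8) ^ (1 + 1) * U) + re8 V +
      nrm8 (⟨3, 0⟩ * V + (⟨1, 1⟩ : R8) ^ (1 + 1) * U) + nrm8 V +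
      t8 (⟨3, 0⟩ * V + (⟨1, 1⟩ : R8) ^ (1 + 1) * U) +
      t8 ((⟨3, 0⟩ + (⟨1, 1⟩ : R8) ^ 2 * ⟨0, 7⟩) * V + (⟨1, 1⟩ : R8) ^ (1 + 1) * U) = 0 := by
  decide

/-- Case `ord z = ord n`, `ord (u - 3dν) = 4`. [folklore] -/
theorem R8.fin_Z3 : ∀ U V : R8, R8.OddPat U → R8.OddPat V →
    R8.SqRel ((⟨3, 0⟩ * V + (⟨1, 1⟩ : R8) ^ (3 + 1) * U) *
      ((⟨3, 0⟩ + (⟨1, 1⟩ : R8) ^ 2 * ⟨0, 7⟩) * V + (⟨1, 1⟩ : R8) ^ (3 + 1) * U) * U) V →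
    re8 (⟨3, 0⟩ * V + (⟨1, 1⟩ : R8) ^ (3 + 1) * U) +
      re8 ((⟨3, 0⟩ + (⟨1, 1⟩ : R8) ^ 2 * ⟨0, 7⟩) * V + (⟨1, 1⟩ : R8) ^ (3 + 1) * U) = 0 ∧
    nrm8 (⟨3, 0⟩ * V + (⟨1, 1⟩ : R8) ^ (3 + 1) * U) +
      nrm8 ((⟨3, 0⟩ + (⟨1, 1⟩ : R8) ^ 2 * ⟨0, 7⟩) * V + (⟨1, 1⟩ : R8) ^ (3 + 1) * U) = 0 ∧
    re8 (⟨3, 0⟩ * V + (⟨1, 1⟩ : R8) ^ (3 + 1) * U) + re8 V +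
      nrm8 (⟨3, 0⟩ * V + (⟨1, 1⟩ : R8) ^ (3 + 1) * U) + nrm8 V +
      t8 (⟨3, 0⟩ * V + (⟨1, 1⟩ : R8) ^ (3 + 1) * U) +
      t8 ((⟨3, 0⟩ + (⟨1, 1⟩ : R8) ^ 2 * ⟨0, 7⟩) * V + (⟨1, 1⟩ : R8) ^ (3 + 1) * U) = 0 := by
  decide

/-- Case `ord z = ord n`, `ord (u - 3dν) ≥ 6`. [folklore] -/
theorem R8.fin_Z5 : ∀ U V : R8, R8.OddPat U → R8.OddPat V →
    R8.SqRel ((⟨3, 0⟩ * V + 0 * U) * ((⟨3, 0⟩ + (⟨1, 1⟩ : R8) ^ 2 * ⟨0, 7⟩) * V + 0 * U) * U) V →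
    re8 (⟨3, 0⟩ * V + 0 * U) + re8 ((⟨3, 0⟩ + (⟨1, 1⟩ : R8) ^ 2 * ⟨0, 7⟩) * V + 0 * U) = 0 ∧
    nrm8 (⟨3, 0⟩ * V + 0 * U) + nrm8 ((⟨3, 0⟩ + (⟨1, 1⟩ : R8) ^ 2 * ⟨0, 7⟩) * V + 0 * U) = 0 ∧
    re8 (⟨3, 0⟩ * V + 0 * U) + re8 V + nrm8 (⟨3, 0⟩ * V + 0 * U) + nrm8 V +
      t8 (⟨3, 0⟩ * V + 0 * U) + t8 ((⟨3, 0⟩ + (⟨1, 1⟩ : R8) ^ 2 * ⟨0, 7⟩) * V + 0 * U) = 0 := by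
  decide

/-- Case `ord z = ord n + 1`. [folklore] -/
theorem R8.fin_O : ∀ U V : R8, R8.OddPat U → R8.OddPat V →
    R8.SqRel (U * (U + ⟨1, 1⟩ * ⟨0, 7⟩ * V) * (⟨1, 1⟩ * U - ⟨3, 0⟩ * V)) V →
    re8 U + re8 (U + ⟨1, 1⟩ * ⟨0, 7⟩ * V) = 1 ∧ nrm8 U + nrm8 (U + ⟨1, 1⟩ * ⟨0, 7⟩ * V) = 1 ∧
    re8 U + re8 V + nrm8 U + nrm8 V + t8 U + t8 (U + ⟨1, 1⟩ * ⟨0, 7⟩ * V) = 0 := by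
  decide

/-- Case `ord z = ord n + 2`, `ord (u + Aν) = 2`. [folklore] -/
theorem R8.fin_T1 : ∀ U V : R8, R8.OddPat U → R8.OddPat V →
    R8.SqRel (((⟨1, 1⟩ : R8) ^ (1 + 1) * U - ⟨0, 7⟩ * V) * U *
      ((⟨1, 1⟩ : R8) ^ (1 + 1 + 2) * U - ((⟨1, 1⟩ : R8) ^ 2 * ⟨0, 7⟩ + ⟨3, 0⟩) * V)) V →
    re8 ((⟨1, 1⟩ : R8) ^ (1 + 1) * U - ⟨0, 7⟩ * V) + re8 U = 0 ∧
    nrm8 ((⟨1, 1⟩ : R8) ^ (1 + 1) * U - ⟨0, 7⟩ * V) + nrm8 U = 0 ∧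
    re8 ((⟨1, 1⟩ : R8) ^ (1 + 1) * U - ⟨0, 7⟩ * V) + re8 V +
      nrm8 ((⟨1, 1⟩ : R8) ^ (1 + 1) * U - ⟨0, 7⟩ * V) + nrm8 V +
      t8 ((⟨1, 1⟩ : R8) ^ (1 + 1) * U - ⟨0, 7⟩ * V) + t8 U = 0 := by
  decide

/-- Case `ord z = ord n + 2`, `ord (u + Aν) = 4`. [folklore] -/
theorem R8.fin_T3 : ∀ U V : R8, R8.OddPat U → R8.OddPat V →
    R8.SqRel (((⟨1, 1⟩ : R8) ^ (3 + 1) * U - ⟨0, 7⟩ * V) * U *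
      ((⟨1, 1⟩ : R8) ^ (3 + 1 + 2) * U - ((⟨1, 1⟩ : R8) ^ 2 * ⟨0, 7⟩ + ⟨3, 0⟩) * V)) V →
    re8 ((⟨1, 1⟩ : R8) ^ (3 + 1) * U - ⟨0, 7⟩ * V) + re8 U = 0 ∧
    nrm8 ((⟨1, 1⟩ : R8) ^ (3 + 1) * U - ⟨0, 7⟩ * V) + nrm8 U = 0 ∧
    re8 ((⟨1, 1⟩ : R8) ^ (3 + 1) * U - ⟨0, 7⟩ * V) + re8 V +
      nrm8 ((⟨1, 1⟩ : R8) ^ (3 + 1) * U - ⟨0, 7⟩ * V) + nrm8 V +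
      t8 ((⟨1, 1⟩ : R8) ^ (3 + 1) * U - ⟨0, 7⟩ * V) + t8 U = 0 := by
  decide

/-- Case `ord z = ord n + 2`, `ord (u + Aν) ≥ 6`. [folklore] -/
theorem R8.fin_T5 : ∀ U V : R8, R8.OddPat U → R8.OddPat V →
    R8.SqRel ((0 * U - ⟨0, 7⟩ * V) * U * (0 * U - ((⟨1, 1⟩ : R8) ^ 2 * ⟨0, 7⟩ + ⟨3, 0⟩) * V)) V →
    re8 (0 * U - ⟨0, 7⟩ * V) + re8 U = 0 ∧ nrm8 (0 * U - ⟨0, 7⟩ * V) + nrm8 U = 0 ∧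
    re8 (0 * U - ⟨0, 7⟩ * V) + re8 V + nrm8 (0 * U - ⟨0, 7⟩ * V) + nrm8 V +
      t8 (0 * U - ⟨0, 7⟩ * V) + t8 U = 0 := by
  decide

/-- Case `ord z = ord n + 4`. [folklore] -/
theorem R8.fin_L1 : ∀ U V : R8, R8.OddPat U → R8.OddPat V →
    R8.SqRel (U * ((⟨1, 1⟩ : R8) ^ (1 + 1) * U + ⟨0, 7⟩ * V) *
      ((⟨1, 1⟩ : R8) ^ (1 + 3) * U - ⟨3, 0⟩ * V)) V →
    re8 U + re8 ((⟨1, 1⟩ : R8) ^ (1 + 1) * U + ⟨0, 7⟩ * V) = 0 ∧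
    nrm8 U + nrm8 ((⟨1, 1⟩ : R8) ^ (1 + 1) * U + ⟨0, 7⟩ * V) = 0 ∧
    re8 U + re8 V + nrm8 U + nrm8 V + t8 U + t8 ((⟨1, 1⟩ : R8) ^ (1 + 1) * U + ⟨0, 7⟩ * V) = 0 := by
  decide

/-- Case `ord z = ord n + 6`. [folklore] -/
theorem R8.fin_L3 : ∀ U V : R8, R8.OddPat U → R8.OddPat V →
    R8.SqRel (U * ((⟨1, 1⟩ : R8) ^ (3 + 1) * U + ⟨0, 7⟩ * V) *
      ((⟨1, 1⟩ : R8) ^ (3 + 3) * U - ⟨3, 0⟩ * V)) V →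
    re8 U + re8 ((⟨1, 1⟩ : R8) ^ (3 + 1) * U + ⟨0, 7⟩ * V) = 0 ∧
    nrm8 U + nrm8 ((⟨1, 1⟩ : R8) ^ (3 + 1) * U + ⟨0, 7⟩ * V) = 0 ∧
    re8 U + re8 V + nrm8 U + nrm8 V + t8 U + t8 ((⟨1, 1⟩ : R8) ^ (3 + 1) * U + ⟨0, 7⟩ * V) = 0 := by
  decide

/-- Case `ord z ≥ ord n + 8`. [folklore] -/
theorem R8.fin_L5 : ∀ U V : R8, R8.OddPat U → R8.OddPat V →
    R8.SqRel (U * (0 * U + ⟨0, 7⟩ * V) * (0 * U - ⟨3, 0⟩ * V)) V →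
    re8 U + re8 (0 * U + ⟨0, 7⟩ * V) = 0 ∧ nrm8 U + nrm8 (0 * U + ⟨0, 7⟩ * V) = 0 ∧
    re8 U + re8 V + nrm8 U + nrm8 V + t8 U + t8 (0 * U + ⟨0, 7⟩ * V) = 0 := by
  decide

/-- `X - 3Y` is even for `X, Y` odd. [folklore] -/
theorem R8.not_oddPat_sub_three_mul : ∀ X Y : R8, R8.OddPat X → R8.OddPat Y →
    ¬ R8.OddPat (X - ⟨3, 0⟩ * Y) := by
  decide

/-- `X - iY` is even for `X, Y` odd. [folklore] -/
theorem R8.not_oddPat_add_negI_mul : ∀ X Y : R8, R8.OddPat X → R8.OddPat Y →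
    ¬ R8.OddPat (X + ⟨0, 7⟩ * Y) := by
  decide

end Finite

/-! ### Constants in `ℤ[i]` and their residues -/

/-- `2 = -i (1+i)²`. [folklore] -/
theorem two_eq_gI_g2 : (2 : ℤ[i]) = -gI * g2 ^ 2 := by decide

/-- `8 = i (1+i)⁶`. [folklore] -/
theorem eight_eq_gI_g2 : (8 : ℤ[i]) = gI * g2 ^ 6 := by decide

/-- `red8 (1+i) = ⟨1, 1⟩`. [folklore] -/
theorem red8_g2 : red8 g2 = ⟨1, 1⟩ := red8_mk 1 1

/-- `red8 i = ⟨0, 1⟩`. [folklore] -/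
theorem red8_gI : red8 gI = ⟨0, 1⟩ := red8_mk 0 1

/-- `red8 (1+i)^j = 0` for `j ≥ 6` (`(1+i)⁶ = -8i`). [folklore] -/
theorem red8_g2_pow_eq_zero {j : ℕ} (hj : 6 ≤ j) : red8 g2 ^ j = 0 := by
  obtain ⟨t, rfl⟩ := Nat.exists_eq_add_of_le hj
  rw [pow_add, red8_g2]
  have : (⟨1, 1⟩ : R8) ^ 6 = 0 := by decide
  rw [this, zero_mul]

/-- The valuation parity, `re`, `nrm`, `t` of `(1+i)^j c` for a `(1+i)`-unit `c`. [folklore] -/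
theorem dyadic_values {c : ℤ[i]} (hc : ¬ g2 ∣ c) (j : ℕ) :
    MulBit.ofPrime g2 prime_g2 (g2 ^ j * c) = j ∧ MulBit.dyRe (g2 ^ j * c) = re8 (red8 c) ∧
    MulBit.dyNrm (g2 ^ j * c) = nrm8 (red8 c) ∧ MulBit.dyT (g2 ^ j * c) = t8 (red8 c) :=
  ⟨MulBit.ofPrime_pow_mul prime_g2 hc j, MulBit.dyRe_pow_mul hc j, MulBit.dyNrm_pow_mul hc j,
    MulBit.dyT_pow_mul hc j⟩

/-- Non-divisibility of a product by the prime `1 + i`. [folklore] -/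
theorem not_g2_dvd_mul {x y : ℤ[i]} (hx : ¬ g2 ∣ x) (hy : ¬ g2 ∣ y) : ¬ g2 ∣ x * y :=
  fun h => (prime_g2.dvd_or_dvd h).elim hx hy

/-- Non-divisibility of a power by the prime `1 + i`. [folklore] -/
theorem not_g2_dvd_pow {x : ℤ[i]} (hx : ¬ g2 ∣ x) (j : ℕ) : ¬ g2 ∣ x ^ j :=
  fun h => hx (prime_g2.dvd_of_dvd_pow h)

/-! ### The dyadic local conditions -/

section Main

variable {d e : ℤ} (hde : d = 8 * e + 1) {z n w m u ν W M : ℤ[i]} {k a kw km : ℕ}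
  (hzu : z = g2 ^ k * u) (hu : ¬ g2 ∣ u) (hnν : n = g2 ^ a * ν) (hν : ¬ g2 ∣ ν)
  (hwW : w = g2 ^ kw * W) (hW : ¬ g2 ∣ W) (hmM : m = g2 ^ km * M) (hM : ¬ g2 ∣ M)
  (heq : w ^ 2 * n ^ 3 = m ^ 2 * (z * (z + 2 * d * n) * (z - 3 * d * n)))
  (hZ2 : z + 2 * d * n ≠ 0) (hZ3 : z - 3 * d * n ≠ 0)

/-- The constant `A = -i + (1+i)⁶ e` with `2d = (1+i)² A`. [folklore] -/
def dyA (e : ℤ) : ℤ[i] := -gI + g2 ^ 6 * e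

/-- The constant `B = 3 + 3 i (1+i)⁶ e = 3d`. [folklore] -/
def dyB (e : ℤ) : ℤ[i] := 3 + 3 * gI * g2 ^ 6 * e

include hde in
/-- `2d = (1+i)² A`. [folklore] -/
theorem two_mul_d_eq : 2 * (d : ℤ[i]) = g2 ^ 2 * dyA e := by
  have h16 : (16 : ℤ[i]) = g2 ^ 8 := by decide
  rw [hde, dyA]; push_cast
  linear_combination (8 * (e : ℤ[i]) + 1) * two_eq_gI_g2 - (e : ℤ[i]) * gI * g2 ^ 2 * eight_eq_gI_g2
    - (e : ℤ[i]) * g2 ^ 8 * gI_mul_gI + 0 * h16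

include hde in
/-- `3d = B`. [folklore] -/
theorem three_mul_d_eq : 3 * (d : ℤ[i]) = dyB e := by
  rw [hde, dyB]; push_cast
  linear_combination 3 * (e : ℤ[i]) * eight_eq_gI_g2

/-- `red8 A = -i = ⟨0, 7⟩`. [folklore] -/
theorem red8_dyA (e : ℤ) : red8 (dyA e) = ⟨0, 7⟩ := by
  rw [dyA, map_add, map_neg, map_mul, map_pow, red8_gI, red8_g2_pow_eq_zero le_rfl, zero_mul,
    add_zero]
  decide

/-- `red8 B = 3 = ⟨3, 0⟩`. [folklore] -/
theorem red8_dyB (e : ℤ) : red8 (dyB e) = ⟨3, 0⟩ := by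
  rw [dyB, map_add, map_mul, map_mul, map_mul, map_pow, red8_g2_pow_eq_zero le_rfl, mul_zero,
    zero_mul, add_zero, map_ofNat]
  decide

include hzu hu hnν hν hwW hW hmM hM heq hZ2 hZ3 hde

set_option maxHeartbeats 1000000 in
/-- **The dyadic conditions, integral form.** With the notation of the section (`z = (1+i)^k u`,
`n = (1+i)^a ν`, `w, m` likewise, `w² n³ = m² z (z+2dn)(z-3dn)`, `d = 8e + 1`):
`ord(z) ≡ ord(z + 2dn)`, `ord z + ord n + re(z) + re(z+2dn) ≡ 0`,
`ord z + ord n + nrm(z) + nrm(z+2dn) ≡ 0`, `re z + re n + nrm z + nrm n + t z + t(z+2dn) ≡ 0`.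
[cite: SilvermanAEC2009, Ch. X §1 (Prop. X.1.4, local image at v ∣ 2)] -/
theorem local_dyadic_aux :
    (MulBit.ofPrime g2 prime_g2 z + MulBit.ofPrime g2 prime_g2 (z + 2 * d * n) = 0) ∧
    (MulBit.ofPrime g2 prime_g2 z + MulBit.ofPrime g2 prime_g2 n + MulBit.dyRe z +
      MulBit.dyRe (z + 2 * d * n) = 0) ∧
    (MulBit.ofPrime g2 prime_g2 z + MulBit.ofPrime g2 prime_g2 n + MulBit.dyNrm z +
      MulBit.dyNrm (z + 2 * d * n) = 0) ∧
    (MulBit.dyRe z + MulBit.dyRe n + MulBit.dyNrm z + MulBit.dyNrm n + MulBit.dyT z +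
      MulBit.dyT (z + 2 * d * n) = 0) := by
  obtain ⟨A, hAdef⟩ : ∃ A : ℤ[i], A = dyA e := ⟨_, rfl⟩
  obtain ⟨B, hBdef⟩ : ∃ B : ℤ[i], B = dyB e := ⟨_, rfl⟩
  have hA : 2 * (d : ℤ[i]) = g2 ^ 2 * A := by rw [hAdef]; exact two_mul_d_eq hde
  have hB : 3 * (d : ℤ[i]) = B := by rw [hBdef]; exact three_mul_d_eq hde
  have ρA : red8 A = ⟨0, 7⟩ := by rw [hAdef]; exact red8_dyA e
  have ρB : red8 B = ⟨3, 0⟩ := by rw [hBdef]; exact red8_dyB e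
  have h2dn : 2 * (d : ℤ[i]) * n = g2 ^ (a + 2) * (A * ν) := by
    rw [hA, hnν]; ring
  have h3dn : 3 * (d : ℤ[i]) * n = g2 ^ a * (B * ν) := by
    rw [hB, hnν]; ring
  have hU : R8.OddPat (red8 u) := (oddPat_red8_iff u).mpr hu
  have hV : R8.OddPat (red8 ν) := (oddPat_red8_iff ν).mpr hν
  have hWo : R8.OddPat (red8 W) := (oddPat_red8_iff W).mpr hW
  have hMo : R8.OddPat (red8 M) := (oddPat_red8_iff M).mpr hM
  have two : ∀ t : ZMod 2, t + t = 0 := CharTwo.add_self_eq_zero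
  -- the unit equation, given decompositions of the two shifted factors
  have unit_eq : ∀ {j2 j3 : ℕ} {U2 U3 : ℤ[i]}, z + 2 * d * n = g2 ^ j2 * U2 →
      z - 3 * d * n = g2 ^ j3 * U3 → ¬ g2 ∣ U2 → ¬ g2 ∣ U3 →
      2 * kw + 3 * a = 2 * km + (k + j2 + j3) ∧
      R8.SqRel (red8 u * red8 U2 * red8 U3) (red8 ν) := by
    intro j2 j3 U2 U3 h2 h3 hU2 hU3
    have key : g2 ^ (2 * kw + 3 * a) * (W ^ 2 * ν ^ 3) =
        g2 ^ (2 * km + (k + j2 + j3)) * (M ^ 2 * (u * U2 * U3)) := by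
      have h := heq
      rw [h2, h3, hzu, hnν, hwW, hmM] at h
      calc g2 ^ (2 * kw + 3 * a) * (W ^ 2 * ν ^ 3)
          = (g2 ^ kw * W) ^ 2 * (g2 ^ a * ν) ^ 3 := by ring
        _ = (g2 ^ km * M) ^ 2 * (g2 ^ k * u * (g2 ^ j2 * U2) * (g2 ^ j3 * U3)) := h
        _ = g2 ^ (2 * km + (k + j2 + j3)) * (M ^ 2 * (u * U2 * U3)) := by ring
    have hc1 : ¬ g2 ∣ W ^ 2 * ν ^ 3 := not_g2_dvd_mul (not_g2_dvd_pow hW 2) (not_g2_dvd_pow hν 3)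
    have hc2 : ¬ g2 ∣ M ^ 2 * (u * U2 * U3) :=
      not_g2_dvd_mul (not_g2_dvd_pow hM 2) (not_g2_dvd_mul (not_g2_dvd_mul hu hU2) hU3)
    obtain ⟨hexp, hunit⟩ := eq_of_pow_mul_eq_pow_mul prime_g2 hc1 hc2 key
    refine ⟨hexp, R8.sqRel_of_eq hWo hMo hV ?_⟩
    have := congrArg red8 hunit
    simp only [map_mul, map_pow] at this
    calc red8 W * red8 W * (red8 ν * red8 ν * red8 ν) = red8 W ^ 2 * red8 ν ^ 3 := by ring
      _ = red8 M ^ 2 * (red8 u * red8 U2 * red8 U3) := this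
      _ = red8 M * red8 M * (red8 u * red8 U2 * red8 U3) := by ring
  rcases lt_trichotomy k a with hlt | hka | hgt
  · ----------------------------------------------------------------- `k < a`
    obtain ⟨s, hs⟩ := Nat.exists_eq_add_of_lt hlt
    -- `a = k + s + 1`
    obtain ⟨U2, hU2def⟩ : ∃ U2 : ℤ[i], U2 = u + g2 ^ (s + 3) * A * ν := ⟨_, rfl⟩
    obtain ⟨U3, hU3def⟩ : ∃ U3 : ℤ[i], U3 = u - g2 ^ (s + 1) * B * ν := ⟨_, rfl⟩
    have hZ2e : z + 2 * d * n = g2 ^ k * U2 := by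
      rw [h2dn, hzu, hs, hU2def]; ring
    have hZ3e : z - 3 * d * n = g2 ^ k * U3 := by
      rw [h3dn, hzu, hs, hU3def]; ring
    have ρU2 : red8 U2 = red8 u + red8 g2 ^ (s + 3) * ⟨0, 7⟩ * red8 ν := by
      rw [hU2def, map_add, map_mul, map_mul, map_pow, ρA]
    have ρU3 : red8 U3 = red8 u - red8 g2 ^ (s + 1) * ⟨3, 0⟩ * red8 ν := by
      rw [hU3def, map_sub, map_mul, map_mul, map_pow, ρB]
    have hU2o : R8.OddPat (red8 U2) := by
      have e1 : red8 U2 = red8 u + ⟨1, 1⟩ * ((⟨1, 1⟩ : R8) ^ (s + 2) * ⟨0, 7⟩ * red8 ν) := by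
        rw [ρU2, red8_g2]; ring
      rw [e1]; exact R8.oddPat_add_pi_mul _ _ hU
    have hU3o : R8.OddPat (red8 U3) := by
      have e1 : red8 U3 = red8 u - ⟨1, 1⟩ * ((⟨1, 1⟩ : R8) ^ s * ⟨3, 0⟩ * red8 ν) := by
        rw [ρU3, red8_g2]; ring
      rw [e1]; exact R8.oddPat_sub_pi_mul _ _ hU
    have hU2 : ¬ g2 ∣ U2 := (oddPat_red8_iff U2).mp hU2o
    have hU3 : ¬ g2 ∣ U3 := (oddPat_red8_iff U3).mp hU3o
    obtain ⟨hexp, hS⟩ := unit_eq (j2 := k) (j3 := k) (U2 := U2) (U3 := U3) hZ2e hZ3e hU2 hU3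
    obtain ⟨vz, rz, nz, tz⟩ := dyadic_values hu k
    obtain ⟨vn, rn, nn, -⟩ := dyadic_values hν a
    obtain ⟨v2, r2, n2, t2⟩ := dyadic_values hU2 k
    rw [← hzu] at vz rz nz tz
    rw [← hnν] at vn rn nn
    rw [← hZ2e] at v2 r2 n2 t2
    rw [vz, v2, vn, rz, rn, r2, nz, nn, n2, tz, t2, ρU2]
    -- parity: `s` is odd
    have hsodd : s % 2 = 1 := by omega
    have hka2 : ((k : ℕ) : ZMod 2) + (a : ℕ) = 0 := by
      rw [hs]; push_cast
      have : ((s : ℕ) : ZMod 2) = 1 := by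
        rw [ZMod.natCast_eq_one_iff_odd, Nat.odd_iff]; exact hsodd
      rw [this]; linear_combination (norm := (ring_nf; reduce_mod_char))
    rcases Nat.lt_or_ge s 5 with hs5 | hs5
    · have hs13 : s = 1 ∨ s = 3 := by omega
      rcases hs13 with rfl | rfl
      · obtain ⟨F1, F2, F3⟩ := R8.fin_N1 _ _ hU hV (by rw [ρU2, ρU3, red8_g2] at hS; exact hS)
        rw [red8_g2]
        refine ⟨two _, ?_, ?_, F3⟩
        · rw [add_assoc, F1, add_zero]; exact hka2
        · rw [add_assoc, F2, add_zero]; exact hka2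
      · obtain ⟨F1, F2, F3⟩ := R8.fin_N3 _ _ hU hV (by rw [ρU2, ρU3, red8_g2] at hS; exact hS)
        rw [red8_g2]
        refine ⟨two _, ?_, ?_, F3⟩
        · rw [add_assoc, F1, add_zero]; exact hka2
        · rw [add_assoc, F2, add_zero]; exact hka2
    · have hp1 : red8 g2 ^ (s + 3) = 0 := red8_g2_pow_eq_zero (by omega)
      have hp2 : red8 g2 ^ (s + 1) = 0 := red8_g2_pow_eq_zero (by omega)
      obtain ⟨F1, F2, F3⟩ := R8.fin_N5 _ _ hU hV (by rw [ρU2, ρU3, hp1, hp2] at hS; exact hS)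
      rw [hp1]
      refine ⟨two _, ?_, ?_, F3⟩
      · rw [add_assoc, F1, add_zero]; exact hka2
      · rw [add_assoc, F2, add_zero]; exact hka2
  · ----------------------------------------------------------------- `k = a`
    -- `u - Bν` is divisible by `1+i`; write it as `(1+i)^(r+1) U3`
    have hUB0 : u - B * ν ≠ 0 := by
      intro h0
      apply hZ3
      rw [h3dn, hzu, hka, ← mul_sub, h0, mul_zero]
    have hUBdvd : g2 ∣ u - B * ν := by
      rw [← not_not (a := g2 ∣ u - B * ν), ← oddPat_red8_iff, map_sub, map_mul, ρB]
      exact R8.not_oddPat_sub_three_mul _ _ hU hV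
    obtain ⟨U3, hU3e, hU3⟩ := exists_eq_pow_multiplicity_mul prime_g2 hUB0
    have hr0pos : 0 < multiplicity g2 (u - B * ν) :=
      (finiteMultiplicity_of_prime prime_g2 hUB0).lt_multiplicity_of_lt_emultiplicity (by
        rw [Nat.cast_zero]; exact emultiplicity_pos_of_dvd hUBdvd)
    obtain ⟨r, hr⟩ : ∃ r, multiplicity g2 (u - B * ν) = r + 1 :=
      ⟨multiplicity g2 (u - B * ν) - 1, by omega⟩
    rw [hr] at hU3e
    have hue : u = B * ν + g2 ^ (r + 1) * U3 := by rw [← hU3e]; ring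
    obtain ⟨U2, hU2def⟩ : ∃ U2 : ℤ[i], U2 = (B + g2 ^ 2 * A) * ν + g2 ^ (r + 1) * U3 := ⟨_, rfl⟩
    have hZ2e : z + 2 * d * n = g2 ^ k * U2 := by
      rw [h2dn, hzu, hka, hue, hU2def]; ring
    have hZ3e : z - 3 * d * n = g2 ^ (k + (r + 1)) * U3 := by
      rw [h3dn, hzu, hka, pow_add, mul_assoc, ← hU3e]; ring
    have hU3o : R8.OddPat (red8 U3) := (oddPat_red8_iff U3).mpr hU3
    have ρu : red8 u = ⟨3, 0⟩ * red8 ν + red8 g2 ^ (r + 1) * red8 U3 := by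
      rw [hue, map_add, map_mul, map_mul, map_pow, ρB]
    have ρU2 : red8 U2 = (⟨3, 0⟩ + red8 g2 ^ 2 * ⟨0, 7⟩) * red8 ν + red8 g2 ^ (r + 1) * red8 U3 := by
      rw [hU2def, map_add, map_mul, map_add, map_mul, map_mul, map_pow, map_pow, ρA, ρB]
    have hU2o : R8.OddPat (red8 U2) := by
      have e1 : red8 U2 = ⟨1, 1⟩ * ((⟨1, 1⟩ : R8) ^ r * red8 U3) +
          (⟨3, 0⟩ + (⟨1, 1⟩ : R8) ^ 2 * ⟨0, 7⟩) * red8 ν := by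
        rw [ρU2, red8_g2]; ring
      rw [e1]; exact R8.oddPat_pi_mul_add _ _ (R8.oddPat_mul _ _ (by decide) hV)
    have hU2 : ¬ g2 ∣ U2 := (oddPat_red8_iff U2).mp hU2o
    obtain ⟨hexp, hS⟩ := unit_eq (j2 := k) (j3 := k + (r + 1)) (U2 := U2) (U3 := U3) hZ2e hZ3e hU2 hU3
    obtain ⟨vz, rz, nz, tz⟩ := dyadic_values hu k
    obtain ⟨vn, rn, nn, -⟩ := dyadic_values hν a
    obtain ⟨v2, r2, n2, t2⟩ := dyadic_values hU2 k
    rw [← hzu] at vz rz nz tz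
    rw [← hnν] at vn rn nn
    rw [← hZ2e] at v2 r2 n2 t2
    rw [vz, v2, vn, rz, rn, r2, nz, nn, n2, tz, t2, ρU2, ρu, hka]
    have hrodd : r % 2 = 1 := by omega
    rcases Nat.lt_or_ge r 5 with hr5 | hr5
    · have hr13 : r = 1 ∨ r = 3 := by omega
      rcases hr13 with rfl | rfl
      · obtain ⟨F1, F2, F3⟩ := R8.fin_Z1 _ _ hU3o hV (by rw [ρu, ρU2, red8_g2] at hS; exact hS)
        rw [red8_g2]
        exact ⟨two _, by rw [two, zero_add]; exact F1, by rw [two, zero_add]; exact F2, F3⟩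
      · obtain ⟨F1, F2, F3⟩ := R8.fin_Z3 _ _ hU3o hV (by rw [ρu, ρU2, red8_g2] at hS; exact hS)
        rw [red8_g2]
        exact ⟨two _, by rw [two, zero_add]; exact F1, by rw [two, zero_add]; exact F2, F3⟩
    · have hp1 : red8 g2 ^ (r + 1) = 0 := red8_g2_pow_eq_zero (by omega)
      obtain ⟨F1, F2, F3⟩ := R8.fin_Z5 _ _ hU3o hV (by
        rw [ρu, ρU2, hp1, red8_g2] at hS; exact hS)
      rw [hp1, red8_g2]
      exact ⟨two _, by rw [two, zero_add]; exact F1, by rw [two, zero_add]; exact F2, F3⟩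
  · rcases Nat.lt_or_ge (a + 1) k with hgt2 | hle1
    · rcases Nat.lt_or_ge (a + 2) k with hgt3 | hle2
      · ------------------------------------------------------------- `k ≥ a + 3`
        obtain ⟨s, hs⟩ : ∃ s, k = a + 3 + s := ⟨k - (a + 3), by omega⟩
        -- `k = a + 3 + s`
        obtain ⟨U2, hU2def⟩ : ∃ U2 : ℤ[i], U2 = g2 ^ (s + 1) * u + A * ν := ⟨_, rfl⟩
        obtain ⟨U3, hU3def⟩ : ∃ U3 : ℤ[i], U3 = g2 ^ (s + 3) * u - B * ν := ⟨_, rfl⟩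
        have hZ2e : z + 2 * d * n = g2 ^ (a + 2) * U2 := by
          rw [h2dn, hzu, hs, hU2def]; ring
        have hZ3e : z - 3 * d * n = g2 ^ a * U3 := by
          rw [h3dn, hzu, hs, hU3def]; ring
        have ρU2 : red8 U2 = red8 g2 ^ (s + 1) * red8 u + ⟨0, 7⟩ * red8 ν := by
          rw [hU2def, map_add, map_mul, map_mul, map_pow, ρA]
        have ρU3 : red8 U3 = red8 g2 ^ (s + 3) * red8 u - ⟨3, 0⟩ * red8 ν := by
          rw [hU3def, map_sub, map_mul, map_mul, map_pow, ρB]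
        have hU2o : R8.OddPat (red8 U2) := by
          have e1 : red8 U2 = ⟨1, 1⟩ * ((⟨1, 1⟩ : R8) ^ s * red8 u) + ⟨0, 7⟩ * red8 ν := by
            rw [ρU2, red8_g2]; ring
          rw [e1]; exact R8.oddPat_pi_mul_add _ _ (R8.oddPat_mul _ _ (by decide) hV)
        have hU3o : R8.OddPat (red8 U3) := by
          have e1 : red8 U3 = ⟨1, 1⟩ * ((⟨1, 1⟩ : R8) ^ (s + 2) * red8 u) - ⟨3, 0⟩ * red8 ν := by
            rw [ρU3, red8_g2]; ring
          rw [e1]; exact R8.oddPat_pi_mul_sub _ _ (R8.oddPat_mul _ _ (by decide) hV)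
        have hU2 : ¬ g2 ∣ U2 := (oddPat_red8_iff U2).mp hU2o
        have hU3 : ¬ g2 ∣ U3 := (oddPat_red8_iff U3).mp hU3o
        obtain ⟨hexp, hS⟩ := unit_eq (j2 := a + 2) (j3 := a) (U2 := U2) (U3 := U3) hZ2e hZ3e hU2 hU3
        obtain ⟨vz, rz, nz, tz⟩ := dyadic_values hu k
        obtain ⟨vn, rn, nn, -⟩ := dyadic_values hν a
        obtain ⟨v2, r2, n2, t2⟩ := dyadic_values hU2 (a + 2)
        rw [← hzu] at vz rz nz tz
        rw [← hnν] at vn rn nn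
        rw [← hZ2e] at v2 r2 n2 t2
        rw [vz, v2, vn, rz, rn, r2, nz, nn, n2, tz, t2, ρU2, hs]
        have hsodd : s % 2 = 1 := by omega
        have hs1 : ((s : ℕ) : ZMod 2) = 1 := by
          rw [ZMod.natCast_eq_one_iff_odd, Nat.odd_iff]; exact hsodd
        have hpar1 : ((a + 3 + s : ℕ) : ZMod 2) + ((a + 2 : ℕ) : ZMod 2) = 0 := by
          push_cast; rw [hs1]; linear_combination (norm := (ring_nf; reduce_mod_char))
        have hpar2 : ((a + 3 + s : ℕ) : ZMod 2) + (a : ℕ) = 0 := by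
          push_cast; rw [hs1]; linear_combination (norm := (ring_nf; reduce_mod_char))
        rcases Nat.lt_or_ge s 5 with hs5 | hs5
        · have hs13 : s = 1 ∨ s = 3 := by omega
          rcases hs13 with rfl | rfl
          · obtain ⟨F1, F2, F3⟩ := R8.fin_L1 _ _ hU hV (by rw [ρU2, ρU3, red8_g2] at hS; exact hS)
            rw [red8_g2]
            refine ⟨hpar1, ?_, ?_, F3⟩
            · rw [add_assoc, F1, add_zero]; exact hpar2
            · rw [add_assoc, F2, add_zero]; exact hpar2
          · obtain ⟨F1, F2, F3⟩ := R8.fin_L3 _ _ hU hV (by rw [ρU2, ρU3, red8_g2] at hS; exact hS)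
            rw [red8_g2]
            refine ⟨hpar1, ?_, ?_, F3⟩
            · rw [add_assoc, F1, add_zero]; exact hpar2
            · rw [add_assoc, F2, add_zero]; exact hpar2
        · have hp1 : red8 g2 ^ (s + 1) = 0 := red8_g2_pow_eq_zero (by omega)
          have hp2 : red8 g2 ^ (s + 3) = 0 := red8_g2_pow_eq_zero (by omega)
          obtain ⟨F1, F2, F3⟩ := R8.fin_L5 _ _ hU hV (by rw [ρU2, ρU3, hp1, hp2] at hS; exact hS)
          rw [hp1]
          refine ⟨hpar1, ?_, ?_, F3⟩
          · rw [add_assoc, F1, add_zero]; exact hpar2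
          · rw [add_assoc, F2, add_zero]; exact hpar2
      · ------------------------------------------------------------- `k = a + 2`
        have hk2 : k = a + 2 := le_antisymm hle2 hgt2
        have hUA0 : u + A * ν ≠ 0 := by
          intro h0
          apply hZ2
          rw [h2dn, hzu, hk2, ← mul_add, h0, mul_zero]
        have hUAdvd : g2 ∣ u + A * ν := by
          rw [← not_not (a := g2 ∣ u + A * ν), ← oddPat_red8_iff, map_add, map_mul, ρA]
          exact R8.not_oddPat_add_negI_mul _ _ hU hV
        obtain ⟨U2, hU2e, hU2⟩ := exists_eq_pow_multiplicity_mul prime_g2 hUA0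
        have hr0pos : 0 < multiplicity g2 (u + A * ν) :=
          (finiteMultiplicity_of_prime prime_g2 hUA0).lt_multiplicity_of_lt_emultiplicity (by
            rw [Nat.cast_zero]; exact emultiplicity_pos_of_dvd hUAdvd)
        obtain ⟨r, hr⟩ : ∃ r, multiplicity g2 (u + A * ν) = r + 1 :=
          ⟨multiplicity g2 (u + A * ν) - 1, by omega⟩
        rw [hr] at hU2e
        have hue : u = g2 ^ (r + 1) * U2 - A * ν := by rw [← hU2e]; ring
        obtain ⟨U3, hU3def⟩ : ∃ U3 : ℤ[i], U3 = g2 ^ (r + 1 + 2) * U2 - (g2 ^ 2 * A + B) * ν := ⟨_, rfl⟩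
        have hZ2e : z + 2 * d * n = g2 ^ (a + 2 + (r + 1)) * U2 := by
          rw [h2dn, hzu, hk2, pow_add _ (a + 2), mul_assoc, ← hU2e]; ring
        have hZ3e : z - 3 * d * n = g2 ^ a * U3 := by
          rw [h3dn, hzu, hk2, hue, hU3def]; ring
        have hU2o : R8.OddPat (red8 U2) := (oddPat_red8_iff U2).mpr hU2
        have ρu : red8 u = red8 g2 ^ (r + 1) * red8 U2 - ⟨0, 7⟩ * red8 ν := by
          rw [hue, map_sub, map_mul, map_mul, map_pow, ρA]
        have ρU3 : red8 U3 = red8 g2 ^ (r + 1 + 2) * red8 U2 -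
            (red8 g2 ^ 2 * ⟨0, 7⟩ + ⟨3, 0⟩) * red8 ν := by
          rw [hU3def, map_sub, map_mul, map_mul, map_add, map_mul, map_pow, map_pow, ρA, ρB]
        have hU3o : R8.OddPat (red8 U3) := by
          have e1 : red8 U3 = ⟨1, 1⟩ * ((⟨1, 1⟩ : R8) ^ (r + 2) * red8 U2) -
              ((⟨1, 1⟩ : R8) ^ 2 * ⟨0, 7⟩ + ⟨3, 0⟩) * red8 ν := by
            rw [ρU3, red8_g2]; ring
          rw [e1]; exact R8.oddPat_pi_mul_sub _ _ (R8.oddPat_mul _ _ (by decide) hV)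
        have hU3 : ¬ g2 ∣ U3 := (oddPat_red8_iff U3).mp hU3o
        obtain ⟨hexp, hS⟩ := unit_eq (j2 := a + 2 + (r + 1)) (j3 := a) (U2 := U2) (U3 := U3) hZ2e hZ3e hU2 hU3
        obtain ⟨vz, rz, nz, tz⟩ := dyadic_values hu k
        obtain ⟨vn, rn, nn, -⟩ := dyadic_values hν a
        obtain ⟨v2, r2, n2, t2⟩ := dyadic_values hU2 (a + 2 + (r + 1))
        rw [← hzu] at vz rz nz tz
        rw [← hnν] at vn rn nn
        rw [← hZ2e] at v2 r2 n2 t2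
        rw [vz, v2, vn, rz, rn, r2, nz, nn, n2, tz, t2, ρu, hk2]
        have hrodd : r % 2 = 1 := by omega
        have hr1 : ((r : ℕ) : ZMod 2) = 1 := by
          rw [ZMod.natCast_eq_one_iff_odd, Nat.odd_iff]; exact hrodd
        have hpar1 : ((a + 2 : ℕ) : ZMod 2) + ((a + 2 + (r + 1) : ℕ) : ZMod 2) = 0 := by
          push_cast; rw [hr1]; linear_combination (norm := (ring_nf; reduce_mod_char))
        have hpar2 : ((a + 2 : ℕ) : ZMod 2) + (a : ℕ) = 0 := by
          push_cast; linear_combination (norm := (ring_nf; reduce_mod_char))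
        rcases Nat.lt_or_ge r 5 with hr5 | hr5
        · have hr13 : r = 1 ∨ r = 3 := by omega
          rcases hr13 with rfl | rfl
          · obtain ⟨F1, F2, F3⟩ := R8.fin_T1 _ _ hU2o hV (by rw [ρu, ρU3, red8_g2] at hS; exact hS)
            rw [red8_g2]
            refine ⟨hpar1, ?_, ?_, F3⟩
            · rw [add_assoc, F1, add_zero]; exact hpar2
            · rw [add_assoc, F2, add_zero]; exact hpar2
          · obtain ⟨F1, F2, F3⟩ := R8.fin_T3 _ _ hU2o hV (by rw [ρu, ρU3, red8_g2] at hS; exact hS)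
            rw [red8_g2]
            refine ⟨hpar1, ?_, ?_, F3⟩
            · rw [add_assoc, F1, add_zero]; exact hpar2
            · rw [add_assoc, F2, add_zero]; exact hpar2
        · have hp1 : red8 g2 ^ (r + 1) = 0 := red8_g2_pow_eq_zero (by omega)
          have hp2 : red8 g2 ^ (r + 1 + 2) = 0 := red8_g2_pow_eq_zero (by omega)
          obtain ⟨F1, F2, F3⟩ := R8.fin_T5 _ _ hU2o hV (by
            rw [ρu, ρU3, hp1, hp2, red8_g2] at hS; exact hS)
          rw [hp1]
          refine ⟨hpar1, ?_, ?_, F3⟩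
          · rw [add_assoc, F1, add_zero]; exact hpar2
          · rw [add_assoc, F2, add_zero]; exact hpar2
    · --------------------------------------------------------------- `k = a + 1`
      have hk1 : k = a + 1 := le_antisymm hle1 hgt
      obtain ⟨U2, hU2def⟩ : ∃ U2 : ℤ[i], U2 = u + g2 * A * ν := ⟨_, rfl⟩
      obtain ⟨U3, hU3def⟩ : ∃ U3 : ℤ[i], U3 = g2 * u - B * ν := ⟨_, rfl⟩
      have hZ2e : z + 2 * d * n = g2 ^ (a + 1) * U2 := by
        rw [h2dn, hzu, hk1, hU2def]; ring
      have hZ3e : z - 3 * d * n = g2 ^ a * U3 := by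
        rw [h3dn, hzu, hk1, hU3def]; ring
      have ρU2 : red8 U2 = red8 u + ⟨1, 1⟩ * ⟨0, 7⟩ * red8 ν := by
        rw [hU2def, map_add, map_mul, map_mul, red8_g2, ρA]
      have ρU3 : red8 U3 = ⟨1, 1⟩ * red8 u - ⟨3, 0⟩ * red8 ν := by
        rw [hU3def, map_sub, map_mul, map_mul, red8_g2, ρB]
      have hU2o : R8.OddPat (red8 U2) := by
        have e1 : red8 U2 = red8 u + ⟨1, 1⟩ * (⟨0, 7⟩ * red8 ν) := by rw [ρU2]; ring
        rw [e1]; exact R8.oddPat_add_pi_mul _ _ hU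
      have hU3o : R8.OddPat (red8 U3) := by
        rw [ρU3]; exact R8.oddPat_pi_mul_sub _ _ (R8.oddPat_mul _ _ (by decide) hV)
      have hU2 : ¬ g2 ∣ U2 := (oddPat_red8_iff U2).mp hU2o
      have hU3 : ¬ g2 ∣ U3 := (oddPat_red8_iff U3).mp hU3o
      obtain ⟨-, hS⟩ := unit_eq (j2 := a + 1) (j3 := a) (U2 := U2) (U3 := U3) hZ2e hZ3e hU2 hU3
      obtain ⟨vz, rz, nz, tz⟩ := dyadic_values hu k
      obtain ⟨vn, rn, nn, -⟩ := dyadic_values hν a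
      obtain ⟨v2, r2, n2, t2⟩ := dyadic_values hU2 (a + 1)
      rw [← hzu] at vz rz nz tz
      rw [← hnν] at vn rn nn
      rw [← hZ2e] at v2 r2 n2 t2
      rw [vz, v2, vn, rz, rn, r2, nz, nn, n2, tz, t2, ρU2, hk1]
      obtain ⟨F1, F2, F3⟩ := R8.fin_O _ _ hU hV (by rw [ρU2, ρU3] at hS; exact hS)
      have hpar : ((a + 1 : ℕ) : ZMod 2) + (a : ℕ) = 1 := by
        push_cast; linear_combination (norm := (ring_nf; reduce_mod_char))
      refine ⟨two _, ?_, ?_, F3⟩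
      · rw [add_assoc, F1, hpar]; decide
      · rw [add_assoc, F2, hpar]; decide

end Main

/-- **The dyadic local conditions for the twists `E^{(d)}`, `d ≡ 1 (mod 8)`** (Silverman AEC
X.1, proof of Prop. X.1.4 at the place above `2`; here for `K1 = ℚ(√-1)`, `𝔭 = (1+i)`): for a
point encoded as `w² n³ = m² z (z + 2dn)(z - 3dn)` (`w, n, m ≠ 0`),
`ord(z) ≡ ord(z + 2dn)`, `ord z + ord n + re(z) + re(z + 2dn) ≡ 0`,
`ord z + ord n + nrm(z) + nrm(z + 2dn) ≡ 0` and `re z + re n + nrm z + nrm n + t z + t(z + 2dn) ≡ 0`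
(all mod `2`); i.e. for `b₁ = z/n`, `b₂ = (z + 2dn)/n`: `ord b₁ ≡ ord b₂`,
`ord b₁ + re b₁ + re b₂ ≡ 0`, `ord b₁ + nrm b₁ + nrm b₂ ≡ 0`, `re b₁ + nrm b₁ + t b₁ + t b₂ ≡ 0`.
[cite: SilvermanAEC2009, Ch. X §1 (Prop. X.1.4, local image at v ∣ 2)] -/
theorem local_dyadic {d : ℤ} (hd : d % 8 = 1) {z n w m : ℤ[i]} (hn : n ≠ 0) (hm : m ≠ 0)
    (hw : w ≠ 0) (heq : w ^ 2 * n ^ 3 = m ^ 2 * (z * (z + 2 * d * n) * (z - 3 * d * n))) :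
    (MulBit.ofPrime g2 prime_g2 z + MulBit.ofPrime g2 prime_g2 (z + 2 * d * n) = 0) ∧
    (MulBit.ofPrime g2 prime_g2 z + MulBit.ofPrime g2 prime_g2 n + MulBit.dyRe z +
      MulBit.dyRe (z + 2 * d * n) = 0) ∧
    (MulBit.ofPrime g2 prime_g2 z + MulBit.ofPrime g2 prime_g2 n + MulBit.dyNrm z +
      MulBit.dyNrm (z + 2 * d * n) = 0) ∧
    (MulBit.dyRe z + MulBit.dyRe n + MulBit.dyNrm z + MulBit.dyNrm n + MulBit.dyT z +
      MulBit.dyT (z + 2 * d * n) = 0) := by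
  obtain ⟨hz, hZ2, hZ3⟩ := factors_ne_zero_of_eq hn hw heq
  have hde : d = 8 * (d / 8) + 1 := by omega
  obtain ⟨u, hzu, hu⟩ := exists_eq_pow_multiplicity_mul prime_g2 hz
  obtain ⟨ν, hnν, hν⟩ := exists_eq_pow_multiplicity_mul prime_g2 hn
  obtain ⟨W, hwW, hW⟩ := exists_eq_pow_multiplicity_mul prime_g2 hw
  obtain ⟨M, hmM, hM⟩ := exists_eq_pow_multiplicity_mul prime_g2 hm
  exact local_dyadic_aux hde hzu hu hnν hν hwW hW hmM hM heq hZ2 hZ3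

end Literature.Barriers.BirchSwinnertonDyer.DokchitserDokchitser2011
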